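import Summits.KontsevichZagierPeriods.KontsevichZagierPeriods.Theorems.UnfoldedStokesStokesGenerationFibrewiseRungScalingSwaps
import Summits.KontsevichZagierPeriods.KontsevichZagierPeriods.Theorems.UnfoldedStokesStokesGenerationFibrewiseClosureCongr

/-!
# `StokesGeneration` (stmt-KontsevichZagierPeriods-3586) — line `fibrewise_stokes`, stub `stub_hillRelationA`

Registered rung stub HA (rung 19, the FIVE-TERM RELATION of the dilogarithm in Hill's form, wave 3) of the line
`fibrewise_stokes` of the crux `StokesGeneration` (route UnfoldedStokes): **the parametric three-term dlog
certificate A**. On the closed cube `[0,1]³` (`s = x 0` the loop variable, `y = x 1` the homotopy variable,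
`v = x 2` a silent parameter) and for real algebraic `a`, `b` with `|a|, |b| < 1` and a continuous
`ℚ`-semialgebraic coefficient `γ(v)`, the function
`γ(v) · [a(1 − bv)/(1 − a + a(1 − bv)s) − a/(1 − as) + abv/(1 − abvs)]`
is fibrewise-Stokes decomposable (`FibStokesDecomposable 3`, `Theorems/UnfoldedStokesDefs.lean`).

Proof. The bracket is the logarithmic `s`-derivative `L = P_s/P` of the loop
`P(s, v) = (1 − a + a(1 − bv)s)(1 − as)/((1 − a)(1 − abvs))`, which is positive on the cube and satisfies
`P(0, v) = P(1, v) = 1`. Exactly as in rung 2 (`stub_rungCertificate`), with `P' = P L` and the homotopy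
`E = 1 + (P − 1)y > 0`, the primitives `G₀ = γ(v)(P − 1)/E` (direction `0`) and `G₁ = γ(v) y P' (1/P − 1/E)`
(direction `1`) have fibre derivatives `D₀ = γ P'/E²`, `D₁ = γ P'(1/P − 1/E²)` with `D₀ + D₁ = γ P'/P = γ L`, and all
four face values `G₀|_{s=1}`, `G₀|_{s=0}`, `G₁|_{y=1}`, `G₁|_{y=0}` vanish on the cube. The two elements are carried
by closed-cube representations of the continuous `ℚ`-semialgebraic `Dⱼ` (`exists_cubeRep`), the family is
decomposable (`fibStokesDecomposable_of_elements`), and `fibStokesDecomposable_congr_off_null` with the empty null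
set rewrites its sum as `γ L`. Positivity on the cube: `1 − a > 0`, `1 − as > 0`, `1 − abvs > 0`,
`1 − a + a(1 − bv)s ≥ min(1 − a, 1 − abv) > 0`.

References: D. Zagier, *The dilogarithm function* (2007), §I.2 (the five-term relation); J. Ayoub, *Une version
relative de la conjecture des périodes de Kontsevich–Zagier*, Ann. of Math. 181 (2015), Rem. 1.5; M. Kontsevich,
D. Zagier, *Periods* (2001), §1.2.
-/

noncomputable section

-- `Summit.KontsevichZagierPeriods.KontsevichZagierPeriods.…` is the tree's mandated layout (single-conjunct summit).
set_option linter.dupNamespace false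

namespace Summit.KontsevichZagierPeriods.KontsevichZagierPeriods.Cruxes.StokesGeneration.FibrewiseStokes

open MeasureTheory Set
open Literature.NumberTheory.Transcendental
open Literature.NumberTheory.Transcendental.KZ
open Literature.ModelTheory.ExponentialFields (IsSemialgebraic)

/-- For `c < 1` and `p ∈ [0,1]` the denominator `1 − c p` is positive. [folklore] -/
private theorem hillA_den_pos {c : ℝ} (hc : c < 1) {p : ℝ} (hp : p ∈ Set.Icc (0:ℝ) 1) : 0 < 1 - c * p := by
  rcases le_or_gt 0 c with h0 | h0
  · nlinarith [mul_nonneg h0 (sub_nonneg.2 hp.2)]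
  · nlinarith [mul_nonneg (neg_nonneg.2 h0.le) hp.1]

/-- The `s`-derivative of the loop `P(s) = (1 − a + a(1 − bv)s)(1 − as)/((1 − a)(1 − abvs))` in logarithmic form:
`P' = P · [a(1 − bv)/(1 − a + a(1 − bv)s) − a/(1 − as) + abv/(1 − abvs)]` wherever no factor vanishes. [folklore] -/
private theorem hillA_hasDerivAt_loop {a b v s : ℝ} (h1 : 1 - a ≠ 0) (h2 : 1 - a * s ≠ 0)
    (h3 : 1 - a * b * v * s ≠ 0) (h4 : 1 - a + a * (1 - b * v) * s ≠ 0) :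
    HasDerivAt (fun u => (1 - a + a * (1 - b * v) * u) * (1 - a * u) / ((1 - a) * (1 - a * b * v * u)))
      ((1 - a + a * (1 - b * v) * s) * (1 - a * s) / ((1 - a) * (1 - a * b * v * s)) *
        (a * (1 - b * v) / (1 - a + a * (1 - b * v) * s) - a / (1 - a * s) + a * b * v / (1 - a * b * v * s))) s := by
  have hN : HasDerivAt (fun u => (1 - a + a * (1 - b * v) * u) * (1 - a * u))
      (a * (1 - b * v) * 1 * (1 - a * s) + (1 - a + a * (1 - b * v) * s) * (-(a * 1))) s :=
    (((hasDerivAt_id' s).const_mul (a * (1 - b * v))).const_add (1 - a)).fun_mul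
      (((hasDerivAt_id' s).const_mul a).const_sub 1)
  have hM : HasDerivAt (fun u => (1 - a) * (1 - a * b * v * u)) ((1 - a) * (-(a * b * v * 1))) s :=
    (((hasDerivAt_id' s).const_mul (a * b * v)).const_sub 1).const_mul (1 - a)
  refine (hN.fun_div hM (mul_ne_zero h1 h3)).congr_deriv ?_
  field_simp
  ring

/-- **Registered stub `stub_hillRelationA` (rung 19, HA): the parametric three-term dlog certificate A.** On `[0,1]³`
(`s = x 0`, `y = x 1`, `v = x 2`), for real algebraic `|a|, |b| < 1` and a continuous `ℚ`-semialgebraic coefficient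
`γ(v)`, `γ(v) · [a(1 − bv)/(1 − a + a(1 − bv)s) − a/(1 − as) + abv/(1 − abvs)] ∈ Dec`: the bracket is `P_s/P` for the
loop `P = (1 − a + a(1 − bv)s)(1 − as)/((1 − a)(1 − abvs))` (`P(0) = P(1) = 1`, `P > 0`), and the two elements
`E_s[γ(P − 1)/E]`, `E_y[γ y P_s (1/P − 1/E)]`, `E = 1 + (P − 1)y`, certify it (all four faces vanish).
[cite: Zagier2007Dilogarithm, §I.2] -/
theorem stub_hillRelationA (a b : ℝ) (ha : IsAlgebraic ℚ a) (hb : IsAlgebraic ℚ b) (ha1 : |a| < 1) (hb1 : |b| < 1)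
    (γ : ℝ → ℝ) (hγ : IsSemialgebraicFunOn ℚ (Set.pi Set.univ (fun _ : Fin 1 => Set.Icc (0:ℝ) 1)) (fun z => γ (z 0)))
    (hγc : ContinuousOn γ (Set.Icc (0:ℝ) 1)) :
    FibStokesDecomposable 3 (fun x => γ (x 2) * (a * (1 - b * x 2) / (1 - a + a * (1 - b * x 2) * x 0) -
      a / (1 - a * x 0) + a * b * x 2 / (1 - a * b * x 2 * x 0))) := by
  classical
  set C : Set (Fin 3 → ℝ) := Set.pi Set.univ (fun _ : Fin 3 => Set.Icc (0:ℝ) 1) with hC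
  have hCsa : IsSemialgebraic ℚ C := by rw [hC, ← cube_eq_pi]; exact isSemialgebraic_cube
  have hCc : IsCompact C := isCompact_univ_pi fun _ => isCompact_Icc
  have hmem : ∀ x ∈ C, ∀ i, x i ∈ Set.Icc (0:ℝ) 1 := fun x hx i => (Set.mem_univ_pi.mp hx) i
  have hupd : ∀ x ∈ C, ∀ (i : Fin 3), ∀ s ∈ Set.Icc (0:ℝ) 1, Function.update x i s ∈ C :=
    fun x hx i s hs => update_mem_cubePi hx i hs
  have h10 : (1 : Fin 3) ≠ 0 := by decide
  have h20 : (2 : Fin 3) ≠ 0 := by decide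
  have h01 : (0 : Fin 3) ≠ 1 := by decide
  have h21 : (2 : Fin 3) ≠ 1 := by decide
  have h0I : (0:ℝ) ∈ Set.Icc (0:ℝ) 1 := ⟨le_rfl, zero_le_one⟩
  have h1I : (1:ℝ) ∈ Set.Icc (0:ℝ) 1 := ⟨zero_le_one, le_rfl⟩
  have hmulI : ∀ u ∈ Set.Icc (0:ℝ) 1, ∀ w ∈ Set.Icc (0:ℝ) 1, u * w ∈ Set.Icc (0:ℝ) 1 :=
    fun u hu w hw => ⟨mul_nonneg hu.1 hw.1, by nlinarith [hu.1, hu.2, hw.1, hw.2]⟩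
  -- positivity of the denominators on the closed cube
  obtain ⟨ha0, ha1'⟩ := abs_lt.mp ha1
  obtain ⟨hb0, hb1'⟩ := abs_lt.mp hb1
  have hA1 : 0 < 1 - a := by linarith
  have hab : a * b < 1 := by
    nlinarith [mul_pos (show 0 < 1 - a by linarith) (show 0 < 1 + b by linarith),
      mul_pos (show 0 < 1 + a by linarith) (show 0 < 1 - b by linarith)]
  have hS : ∀ x ∈ C, 0 < 1 - a * x 0 := fun x hx => hillA_den_pos ha1' (hmem x hx 0)
  have hT : ∀ x ∈ C, 0 < 1 - a * b * x 2 * x 0 := fun x hx => by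
    have := hillA_den_pos hab (hmulI _ (hmem x hx 2) _ (hmem x hx 0))
    simpa [mul_assoc] using this
  have hBV : ∀ x ∈ C, 0 < 1 - b * x 2 := fun x hx => hillA_den_pos hb1' (hmem x hx 2)
  have hABV : ∀ x ∈ C, 0 < 1 - a * b * x 2 := fun x hx => by
    have := hillA_den_pos hab (hmem x hx 2)
    simpa [mul_assoc] using this
  have hQ : ∀ x ∈ C, 0 < 1 - a + a * (1 - b * x 2) * x 0 := fun x hx => by
    rcases le_or_gt 0 a with h0 | h0
    · have := mul_nonneg (mul_nonneg h0 (hBV x hx).le) (hmem x hx 0).1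
      linarith
    · have := mul_nonneg (mul_nonneg (neg_nonneg.2 h0.le) (hBV x hx).le) (sub_nonneg.2 (hmem x hx 0).2)
      nlinarith [hABV x hx]
  have hSne : ∀ x ∈ C, 1 - a * x 0 ≠ 0 := fun x hx => (hS x hx).ne'
  have hTne : ∀ x ∈ C, 1 - a * b * x 2 * x 0 ≠ 0 := fun x hx => (hT x hx).ne'
  have hQne : ∀ x ∈ C, 1 - a + a * (1 - b * x 2) * x 0 ≠ 0 := fun x hx => (hQ x hx).ne'
  have hMne : ∀ x ∈ C, (1 - a) * (1 - a * b * x 2 * x 0) ≠ 0 := fun x hx => mul_ne_zero hA1.ne' (hTne x hx)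
  -- the loop `P`, its logarithmic `s`-derivative `L`, `P' = P L`, the homotopy `E = 1 + (P − 1) y`
  set P : (Fin 3 → ℝ) → ℝ := fun x =>
    (1 - a + a * (1 - b * x 2) * x 0) * (1 - a * x 0) / ((1 - a) * (1 - a * b * x 2 * x 0)) with hP
  set L : (Fin 3 → ℝ) → ℝ := fun x =>
    a * (1 - b * x 2) / (1 - a + a * (1 - b * x 2) * x 0) - a / (1 - a * x 0) + a * b * x 2 / (1 - a * b * x 2 * x 0)
    with hL
  set P' : (Fin 3 → ℝ) → ℝ := fun x => P x * L x with hP'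
  set E : (Fin 3 → ℝ) → ℝ := fun x => 1 + (P x - 1) * x 1 with hE
  have hPpos : ∀ x ∈ C, 0 < P x := fun x hx =>
    div_pos (mul_pos (hQ x hx) (hS x hx)) (mul_pos hA1 (hT x hx))
  have hPne : ∀ x ∈ C, P x ≠ 0 := fun x hx => (hPpos x hx).ne'
  have hEpos : ∀ x ∈ C, 0 < E x := by
    intro x hx
    obtain ⟨h1l, h1u⟩ := hmem x hx 1
    have hp := hPpos x hx
    show 0 < 1 + (P x - 1) * x 1
    rcases le_total 1 (P x) with h | h
    · nlinarith [mul_nonneg (sub_nonneg.2 h) h1l]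
    · nlinarith [mul_nonneg (sub_nonneg.2 h) (sub_nonneg.2 h1u)]
  have hEne : ∀ x ∈ C, E x ≠ 0 := fun x hx => (hEpos x hx).ne'
  have hE2ne : ∀ x ∈ C, E x ^ 2 ≠ 0 := fun x hx => pow_ne_zero 2 (hEne x hx)
  -- `P = 1` on the faces `s = 0`, `s = 1`; `P`, `L` do not depend on `y`
  have hP00 : ∀ x, P (Function.update x 0 0) = 1 := fun x => by
    simp only [hP, Function.update_self, Function.update_of_ne h20, mul_zero, add_zero, sub_zero, mul_one,
      div_self hA1.ne']
  have hP01 : ∀ x ∈ C, P (Function.update x 0 1) = 1 := fun x hx => by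
    have hden : (1 - a) * (1 - a * b * x 2 * 1) ≠ 0 := by rw [mul_one]; exact mul_ne_zero hA1.ne' (hABV x hx).ne'
    simp only [hP, Function.update_self, Function.update_of_ne h20]
    rw [div_eq_one_iff_eq hden]
    ring
  have hPL1 : ∀ x s, P (Function.update x 1 s) = P x ∧ L (Function.update x 1 s) = L x := fun x s => by
    simp only [hP, hL, Function.update_of_ne h01, Function.update_of_ne h21, and_self]
  -- semialgebraic atoms and closure under field operations (BCR Prop. 2.2.6)
  have hx0 : IsSemialgebraicFunOn ℚ C (fun x => x 0) := isSemialgebraicFunOn_apply hCsa 0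
  have hx1 : IsSemialgebraicFunOn ℚ C (fun x => x 1) := isSemialgebraicFunOn_apply hCsa 1
  have hx2 : IsSemialgebraicFunOn ℚ C (fun x => x 2) := isSemialgebraicFunOn_apply hCsa 2
  have hca : IsSemialgebraicFunOn ℚ C (fun _ => a) := isSemialgebraicFunOn_const_of_isAlgebraic hCsa ha
  have hcb : IsSemialgebraicFunOn ℚ C (fun _ => b) := isSemialgebraicFunOn_const_of_isAlgebraic hCsa hb
  have hc1 : IsSemialgebraicFunOn ℚ C (fun _ => (1:ℝ)) := isSemialgebraicFunOn_const_of_isAlgebraic hCsa isAlgebraic_one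
  have hγsa : IsSemialgebraicFunOn ℚ C (fun x => γ (x 2)) := isSemialgebraicFunOn_read hγ 2
  have hBVsa : IsSemialgebraicFunOn ℚ C (fun x => a * (1 - b * x 2)) := hca.fun_mul (hc1.fun_sub (hcb.fun_mul hx2))
  have hQsa : IsSemialgebraicFunOn ℚ C (fun x => 1 - a + a * (1 - b * x 2) * x 0) :=
    (hc1.fun_sub hca).fun_add (hBVsa.fun_mul hx0)
  have hSsa : IsSemialgebraicFunOn ℚ C (fun x => 1 - a * x 0) := hc1.fun_sub (hca.fun_mul hx0)
  have hTsa : IsSemialgebraicFunOn ℚ C (fun x => 1 - a * b * x 2 * x 0) :=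
    hc1.fun_sub (((hca.fun_mul hcb).fun_mul hx2).fun_mul hx0)
  have hPsa : IsSemialgebraicFunOn ℚ C P := (hQsa.fun_mul hSsa).div ((hc1.fun_sub hca).fun_mul hTsa) hMne
  have hLsa : IsSemialgebraicFunOn ℚ C L :=
    ((hBVsa.div hQsa hQne).fun_sub (hca.div hSsa hSne)).fun_add (((hca.fun_mul hcb).fun_mul hx2).div hTsa hTne)
  have hP'sa : IsSemialgebraicFunOn ℚ C P' := hPsa.fun_mul hLsa
  have hEsa : IsSemialgebraicFunOn ℚ C E := hc1.fun_add ((hPsa.fun_sub hc1).fun_mul hx1)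
  -- continuity atoms on the cube
  have hγC : ContinuousOn (fun x : Fin 3 → ℝ => γ (x 2)) C :=
    hγc.comp (continuous_apply 2).continuousOn fun x hx => hmem x hx 2
  have hx1c : ContinuousOn (fun x : Fin 3 → ℝ => x 1) C := (continuous_apply 1).continuousOn
  have hQc : Continuous fun x : Fin 3 → ℝ => 1 - a + a * (1 - b * x 2) * x 0 := by fun_prop
  have hSc : Continuous fun x : Fin 3 → ℝ => 1 - a * x 0 := by fun_prop
  have hTc : Continuous fun x : Fin 3 → ℝ => 1 - a * b * x 2 * x 0 := by fun_prop
  have hBVc : Continuous fun x : Fin 3 → ℝ => a * (1 - b * x 2) := by fun_prop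
  have hABx2c : Continuous fun x : Fin 3 → ℝ => a * b * x 2 := by fun_prop
  have hPc : ContinuousOn P C :=
    (hQc.mul hSc).continuousOn.div (continuous_const.mul hTc).continuousOn hMne
  have hLc : ContinuousOn L C :=
    ((hBVc.continuousOn.div hQc.continuousOn hQne).sub (continuousOn_const.div hSc.continuousOn hSne)).add
      (hABx2c.continuousOn.div hTc.continuousOn hTne)
  have hP'c : ContinuousOn P' C := hPc.fun_mul hLc
  have hEc : ContinuousOn E C := continuousOn_const.fun_add ((hPc.fun_sub continuousOn_const).fun_mul hx1c)
  have hE2c : ContinuousOn (fun x => E x ^ 2) C := hEc.pow 2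
  -- the witnesses
  set G0 : (Fin 3 → ℝ) → ℝ := fun x => γ (x 2) * (P x - 1) / E x with hG0
  set D0 : (Fin 3 → ℝ) → ℝ := fun x => γ (x 2) * P' x / E x ^ 2 with hD0
  set G1 : (Fin 3 → ℝ) → ℝ := fun x => γ (x 2) * x 1 * P' x * (1 / P x - 1 / E x) with hG1
  set D1 : (Fin 3 → ℝ) → ℝ := fun x => γ (x 2) * P' x * (1 / P x - 1 / E x ^ 2) with hD1
  -- semialgebraicity
  have hG0sa : IsSemialgebraicFunOn ℚ C G0 := (hγsa.fun_mul (hPsa.fun_sub hc1)).div hEsa hEne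
  have hD0sa : IsSemialgebraicFunOn ℚ C D0 := (hγsa.fun_mul hP'sa).div (hEsa.fun_pow 2) hE2ne
  have hG1sa : IsSemialgebraicFunOn ℚ C G1 :=
    ((hγsa.fun_mul hx1).fun_mul hP'sa).fun_mul ((hc1.div hPsa hPne).fun_sub (hc1.div hEsa hEne))
  have hD1sa : IsSemialgebraicFunOn ℚ C D1 :=
    (hγsa.fun_mul hP'sa).fun_mul ((hc1.div hPsa hPne).fun_sub (hc1.div (hEsa.fun_pow 2) hE2ne))
  -- continuity on the cube
  have hG0c : ContinuousOn G0 C := (hγC.fun_mul (hPc.fun_sub continuousOn_const)).div₀ hEc hEne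
  have hD0c : ContinuousOn D0 C := (hγC.fun_mul hP'c).div₀ hE2c hE2ne
  have hG1c : ContinuousOn G1 C :=
    ((hγC.fun_mul hx1c).fun_mul hP'c).fun_mul
      ((continuousOn_const.div₀ hPc hPne).fun_sub (continuousOn_const.div₀ hEc hEne))
  have hD1c : ContinuousOn D1 C :=
    (hγC.fun_mul hP'c).fun_mul ((continuousOn_const.div₀ hPc hPne).fun_sub (continuousOn_const.div₀ hE2c hE2ne))
  -- bounds on the compact cube and continuity along closed fibres
  have hbound : ∀ {F : (Fin 3 → ℝ) → ℝ}, ContinuousOn F C → ∃ B : ℝ, ∀ x ∈ C, |F x| ≤ B := fun hF => by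
    obtain ⟨B, hB⟩ := hCc.exists_bound_of_continuousOn hF
    exact ⟨B, fun x hx => by simpa [Real.norm_eq_abs] using hB x hx⟩
  have hcu : ∀ (x : Fin 3 → ℝ) (i : Fin 3), Continuous fun s : ℝ => Function.update x i s :=
    fun x i => continuous_const.update i continuous_id
  -- all four face values vanish on the cube
  have hG0_one : ∀ x ∈ C, G0 (Function.update x 0 1) = 0 := fun x hx => by
    simp only [hG0, hP01 x hx, sub_self, mul_zero, zero_div]
  have hG0_zero : ∀ x, G0 (Function.update x 0 0) = 0 := fun x => by
    simp only [hG0, hP00 x, sub_self, mul_zero, zero_div]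
  have hG1_one : ∀ x, G1 (Function.update x 1 1) = 0 := fun x => by
    simp only [hG1, hE, Function.update_self]
    ring
  have hG1_zero : ∀ x, G1 (Function.update x 1 0) = 0 := fun x => by
    simp only [hG1, Function.update_self, mul_zero, zero_mul]
  -- derivatives along the fibres: direction `0` for `G0`, direction `1` for `G1`
  have hGder0 : ∀ x ∈ C, HasDerivAt (fun s : ℝ => G0 (Function.update x 0 s)) (D0 x) (x 0) := by
    intro x hx
    have hp := hillA_hasDerivAt_loop (v := x 2) hA1.ne' (hSne x hx) (hTne x hx) (hQne x hx)
    have key := rungCert_hasDerivAt_dir0 (γ := γ (x 2)) (y := x 1) hp (hEne x hx)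
    refine (key.congr_of_eventuallyEq ?_).congr_deriv rfl
    exact Filter.Eventually.of_forall fun s => by
      simp only [hG0, hE, hP, Function.update_self, Function.update_of_ne h10, Function.update_of_ne h20]
  have hGder1 : ∀ x ∈ C, HasDerivAt (fun s : ℝ => G1 (Function.update x 1 s)) (D1 x) (x 1) := by
    intro x hx
    have key := rungCert_hasDerivAt_dir1 (γ := γ (x 2)) (a := P' x) (p := P x) (c := P x - 1)
      (s := x 1) (hEne x hx)
    refine (key.congr_of_eventuallyEq ?_).congr_deriv rfl
    exact Filter.Eventually.of_forall fun s => by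
      have h := hPL1 x s
      simp only [hG1, hP', hE, h.1, h.2, Function.update_self, Function.update_of_ne h21]
  -- the two closed-cube representations, with integrands `D j` (the face terms vanish)
  obtain ⟨q0, hq0d, hq0i⟩ := exists_cubeRep 3 D0 hD0sa hD0c
  obtain ⟨q1, hq1d, hq1i⟩ := exists_cubeRep 3 D1 hD1sa hD1c
  -- assemble the two elements
  have hdec : FibStokesDecomposable 3 (fun x => ∑ j, ((![q0, q1] : Fin 2 → IntegralRep 3) j).integrand x) := by
    refine fibStokesDecomposable_of_elements (M := 3) (J := 2) (![0, 1] : Fin 2 → Fin 3)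
      (![G0, G1] : Fin 2 → (Fin 3 → ℝ) → ℝ) (![D0, D1] : Fin 2 → (Fin 3 → ℝ) → ℝ)
      (![q0, q1] : Fin 2 → IntegralRep 3) ?_ ?_
    · refine Fin.forall_fin_two.mpr ⟨?_, ?_⟩
      · -- element 0, along `s = x 0`
        simp only [Matrix.cons_val_zero]
        refine ⟨hG0sa, hD0sa, hbound hG0c, fun x hx => ?_, fun x hx _ => hGder0 x hx⟩
        show ContinuousOn (fun s : ℝ => G0 (Function.update x 0 s)) (Set.Icc (0:ℝ) 1)
        exact hG0c.comp (hcu x 0).continuousOn fun s hs => hupd x hx 0 s hs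
      · -- element 1, along `y = x 1`
        simp only [Matrix.cons_val_one, Matrix.cons_val_zero]
        refine ⟨hG1sa, hD1sa, hbound hG1c, fun x hx => ?_, fun x hx _ => hGder1 x hx⟩
        show ContinuousOn (fun s : ℝ => G1 (Function.update x 1 s)) (Set.Icc (0:ℝ) 1)
        exact hG1c.comp (hcu x 1).continuousOn fun s hs => hupd x hx 1 s hs
    · refine Fin.forall_fin_two.mpr ⟨?_, ?_⟩
      · simp only [Matrix.cons_val_zero]
        exact ⟨hq0d, fun x hx => by rw [hq0i, hG0_one x hx, hG0_zero x, sub_zero, sub_zero]⟩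
      · simp only [Matrix.cons_val_one, Matrix.cons_val_zero]
        exact ⟨hq1d, fun x _ => by rw [hq1i, hG1_one x, hG1_zero x, sub_zero, sub_zero]⟩
  -- the pointwise identity `D₀ + D₁ = γ P'/P = γ L` on the cube
  refine fibStokesDecomposable_congr_off_null 3 _ _ ∅
    Literature.ModelTheory.ExponentialFields.isSemialgebraic_empty measure_empty (fun x hx _ => ?_) hdec
  show ∑ j, ((![q0, q1] : Fin 2 → IntegralRep 3) j).integrand x = γ (x 2) * L x
  rw [Fin.sum_univ_two]
  simp only [Matrix.cons_val_zero, Matrix.cons_val_one, hq0i, hq1i, hD0, hD1, hP']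
  have h : P x * L x * (1 / P x) = L x := by
    rw [mul_comm (P x) (L x), mul_assoc, mul_one_div_cancel (hPne x hx), mul_one]
  linear_combination γ (x 2) * h

end Summit.KontsevichZagierPeriods.KontsevichZagierPeriods.Cruxes.StokesGeneration.FibrewiseStokes

end
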